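import Literature.NumberTheory.LFunctions.GaussianHeckeHybridMeanValue
import Literature.NumberTheory.LFunctions.ZeroDensityInghamTools
import HarnessLib

/-!
# The class-I count for the family of Hecke `L`-functions `L(s, λ^m)` of `ℚ(i)`

Topic `Literature/NumberTheory/LFunctions`.  Everything in this file is PROVED; no definitions, no named
facts.  This is the `ℚ(i)`-analogue, for the FAMILY `{λ^m}_{|m| ≤ K}`, of the class-I count of the
zero-detection method (the tree's `Literature.NumberTheory.LFunctions.exists_classOne_const` for `ζ`,
Ivić 1985 §11.2–11.3): large values of twisted Hecke polynomials on a dyadic shell at well-spaced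
points are few.

* `GaussianHecke.exists_classOne` — there is an absolute `C₀` such that for `M, K ≥ 1`, `T ≥ 1`, `V > 0`,
  coefficients `b_v` and a finite set `Z` of pairs `(m, ρ)`, `|m| ≤ K`, `ρ = β + iγ` with
  `σ ≤ β ≤ σ + 1/2`, `|γ| ≤ T`, ordinates pairwise `≥ 1` apart for each fixed `m`, each satisfying
  `|∑_{v ∈ ℤ[i]*, M < N(v) ≤ 2M} b_v λ^m(v) N(v)^{-ρ}| ≥ V`:
  `#Z ≤ C₀ (M + K) T log(4M) · B / V²`, `B = ∑_{M < N(v) ≤ 2M} |b_v|² N(v)^{-2σ} g(v) √(2M/N(v))`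
  (`g` = content; the ray-sum majorant of the large sieve for `ℤ[i]`).

Proof exactly as for `ζ`: the factor `N(v)^{-(β−σ)}` is removed by Abel summation over the norm
(`Literature.NumberTheory.LFunctions.norm_sum_Ioc_mul_le_abel`, weights decreasing by at most `1/(2u)`),
the partial sums (truncated twisted Hecke polynomials) are estimated UNIFORMLY in the truncation by the
hybrid mean value theorem `GaussianInt.exists_sum_sum_norm_sq_twist_le` and Cauchy's inequality, and
`∑_{M<u<2M} 1/(2u) ≤ 1/2`.

## References

* A. Ivić, *The Riemann Zeta-Function*, Wiley 1985, §11.2–11.3 (proof of (11.22), bound for `R₁`). [Ivic1985]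
* H. L. Montgomery, *Topics in Multiplicative Number Theory*, LNM 227 (1971), Ch. 12. [Montgomery1971]
-/

noncomputable section

open Complex Finset Real
open scoped ComplexConjugate

namespace Literature.NumberTheory.LFunctions

namespace GaussianHecke

open GaussianInt ZeroDensity

/-- Regrouping a sum over `{v ∈ ℤ[i]* : N(v) ≤ N}` by the norm `n = N(v) ∈ [1, ⌊N⌋]`. [folklore] -/
theorem sum_normLEStar_eq_sum_Icc {N : ℝ} (F : _root_.GaussianInt → ℂ) :
    ∑ v ∈ normLEStar N, F v =
      ∑ n ∈ Icc 1 ⌊N⌋₊, ∑ v ∈ (normLEStar N).filter (fun v ↦ v.norm.natAbs = n), F v := by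
  classical
  symm
  refine sum_fiberwise_of_maps_to (g := fun v : _root_.GaussianInt ↦ v.norm.natAbs) ?_ F
  intro v hv
  rw [mem_normLEStar] at hv
  rw [mem_Icc]
  refine ⟨Nat.one_le_iff_ne_zero.2 (natAbs_norm_ne_zero hv.2), Nat.le_floor ?_⟩
  rw [GaussianInt.natCast_natAbs_norm]; exact hv.1

set_option maxHeartbeats 1600000 in
/-- **The class-I count for the family `{λ^m}`.**  See the module docstring.  Relies on: hypothesis
`hMVT` (the mean value theorem for Hecke polynomials, discharged in the tree:
`JarviniemiTeravainen2024_heckeMVT_holds`). [cite: Ivic1985, §11.3 proof of (11.22), bound for R₁] -/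
theorem exists_classOne (hMVT : JarviniemiTeravainen2024_heckeMVT) : ∃ C₀ : ℝ, 0 ≤ C₀ ∧
    ∀ (b : _root_.GaussianInt → ℂ) (M K : ℕ) (σ T V : ℝ) (Z : Finset (ℤ × ℂ)), 1 ≤ M → 1 ≤ K → 1 ≤ T → 0 < V →
      (∀ p ∈ Z, p.1 ∈ Icc (-(K : ℤ)) K) →
      (∀ p ∈ Z, σ ≤ p.2.re ∧ p.2.re ≤ σ + 1 / 2) → (∀ p ∈ Z, |p.2.im| ≤ T) →
      (∀ p ∈ Z, ∀ p' ∈ Z, p.1 = p'.1 → p ≠ p' → 1 ≤ |p.2.im - p'.2.im|) →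
      (∀ p ∈ Z, V ≤ ‖∑ v ∈ (normLEStar (2 * M)).filter (fun v ↦ M < v.norm.natAbs),
        b v * angularCharZ p.1 v * ((v.norm.natAbs : ℕ) : ℂ) ^ (-p.2)‖) →
      (Z.card : ℝ) ≤ C₀ * (M + K) * T * Real.log (4 * M) *
        (∑ v ∈ (normLEStar (2 * M)).filter (fun v ↦ M < v.norm.natAbs),
          ‖b v‖ ^ 2 * ((v.norm.natAbs : ℕ) : ℝ) ^ (-2 * σ) * (content v * Real.sqrt (2 * M / v.norm))) / V ^ 2 := by
  obtain ⟨C, hC0, hC⟩ := exists_sum_sum_norm_sq_twist_le hMVT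
  refine ⟨9 / 4 * (16 * C), by positivity, ?_⟩
  intro b M K σ T V Z hM hK hT hV hm hre him hsep hlarge
  classical
  -- notation
  set Sh := (normLEStar (2 * M)).filter (fun v ↦ M < v.norm.natAbs) with hSh
  set B : ℝ := ∑ v ∈ Sh, ‖b v‖ ^ 2 * ((v.norm.natAbs : ℕ) : ℝ) ^ (-2 * σ) *
    (content v * Real.sqrt (2 * M / v.norm)) with hB
  have hB0 : 0 ≤ B := sum_nonneg fun v _ ↦ by positivity
  set L : ℝ := Real.log (4 * M) with hL
  have hM1 : (1 : ℝ) ≤ M := by exact_mod_cast hM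
  have hL0 : 0 ≤ L := Real.log_nonneg (by linarith)
  have hlog2M : 1 + Real.log (2 * M) ≤ 4 * L := by
    have h4 : Real.log 4 ≤ L := Real.log_le_log (by norm_num) (by linarith)
    have h2 : Real.log (2 * M) ≤ L := Real.log_le_log (by positivity) (by linarith)
    have h14 : (1 : ℝ) ≤ Real.log 4 := by
      rw [Real.le_log_iff_exp_le (by norm_num)]
      have := Real.exp_one_lt_d9; linarith
    linarith
  -- the coefficients `a_u(v) = b(v) N(v)^{-σ}` on `M < N(v) ≤ u`
  set a : ℕ → _root_.GaussianInt → ℂ := fun u v ↦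
    if M < v.norm.natAbs ∧ v.norm.natAbs ≤ u then b v * ((((v.norm.natAbs : ℕ) : ℝ) ^ (-σ) : ℝ) : ℂ) else 0
    with ha
  -- partial sums `S_u(m, t)` (truncated twisted Hecke polynomials)
  set S : ℕ → ℤ → ℝ → ℂ := fun u m t ↦
    heckeSum (2 * M) (fun v ↦ a u v * ((v.norm.natAbs : ℕ) : ℂ) ^ (-((t : ℂ) * I))) m with hS
  -- the weight of `a_u` is at most `B`
  have hWa : ∀ u, ∑ v ∈ normLEStar (2 * M), ‖a u v‖ ^ 2 * (content v * Real.sqrt (2 * M / v.norm)) ≤ B := by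
    intro u
    rw [hB, hSh, sum_filter]
    refine sum_le_sum fun v hv ↦ ?_
    have hw : 0 ≤ (content v : ℝ) * Real.sqrt (2 * M / v.norm) := by positivity
    simp only [ha]
    by_cases h : M < v.norm.natAbs ∧ v.norm.natAbs ≤ u
    · rw [if_pos h, if_pos h.1, norm_mul, mul_pow, Complex.norm_real,
        Real.norm_of_nonneg (Real.rpow_nonneg (Nat.cast_nonneg _) _), rpow_neg_sq (Nat.cast_nonneg _)]
    · rw [if_neg h, norm_zero]
      split_ifs
      · simp only [ne_eq, OfNat.ofNat_ne_zero, not_false_eq_true, zero_pow, zero_mul]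
        positivity
      · simp
  -- Step 1: the hybrid MVT for each `u`, over the points of `Z`
  have hMVTu : ∀ u, ∑ p ∈ Z, ‖S u p.1 p.2.im‖ ^ 2 ≤ 16 * C * (M + K) * T * L * B := by
    intro u
    -- the point sets `𝒯_m`
    set 𝒯 : ℤ → Finset ℝ := fun m ↦ (Z.filter (fun p ↦ p.1 = m)).image (fun p ↦ p.2.im) with h𝒯
    have hmemT : ∀ m, ∀ t ∈ 𝒯 m, (-T - 1) + 1 / 2 ≤ t ∧ t ≤ (T + 1) - 1 / 2 := by
      intro m t ht
      simp only [h𝒯, mem_image, mem_filter] at ht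
      obtain ⟨p, ⟨hp, -⟩, rfl⟩ := ht
      have := him p hp
      rw [abs_le] at this
      constructor <;> linarith
    have hsepT : ∀ m, ∀ t ∈ 𝒯 m, ∀ t' ∈ 𝒯 m, t ≠ t' → (1 : ℝ) ≤ |t - t'| := by
      intro m t ht t' ht' hne
      simp only [h𝒯, mem_image, mem_filter] at ht ht'
      obtain ⟨p, ⟨hp, hpm⟩, rfl⟩ := ht
      obtain ⟨p', ⟨hp', hp'm⟩, rfl⟩ := ht'
      exact hsep p hp p' hp' (hpm.trans hp'm.symm) fun h ↦ hne (by rw [h])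
    have h2M : (1 : ℝ) ≤ 2 * M := by linarith
    have h1 := hC (2 * M) K (a u) 𝒯 1 (-T - 1) (T + 1) h2M hK one_pos (by linarith) hmemT hsepT
    -- the left side of `h1` dominates `∑_{p ∈ Z} ‖S u p‖²`
    have hinj : ∀ m, Set.InjOn (fun p : ℤ × ℂ ↦ p.2.im) ↑(Z.filter (fun p ↦ p.1 = m)) := by
      intro m p hp p' hp' h
      rw [mem_coe, mem_filter] at hp hp'
      by_contra hne
      have := hsep p hp.1 p' hp'.1 (hp.2.trans hp'.2.symm) hne
      rw [show p.2.im = p'.2.im from h, sub_self, abs_zero] at this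
      linarith
    have hZsum : ∑ p ∈ Z, ‖S u p.1 p.2.im‖ ^ 2 = ∑ m ∈ Icc (-(K : ℤ)) K, ∑ t ∈ 𝒯 m, ‖S u m t‖ ^ 2 := by
      rw [← sum_fiberwise_of_maps_to (g := fun p : ℤ × ℂ ↦ p.1) (fun p hp ↦ hm p hp)]
      refine sum_congr rfl fun m _ ↦ ?_
      rw [h𝒯, sum_image (hinj m)]
      refine sum_congr rfl fun p hp ↦ ?_
      rw [mem_filter] at hp
      rw [hp.2]
    rw [hZsum]
    refine h1.trans ?_
    -- combine with the weight bound
    have hW := hWa u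
    have hK0 : (0 : ℝ) ≤ K := Nat.cast_nonneg K
    calc C * (2 * M + K) * ((T + 1) - (-T - 1)) * (1⁻¹ + Real.log (2 * M)) *
          ∑ v ∈ normLEStar (2 * M), ‖a u v‖ ^ 2 * (content v * Real.sqrt (2 * M / v.norm))
        ≤ C * (2 * M + K) * ((T + 1) - (-T - 1)) * (1⁻¹ + Real.log (2 * M)) * B := by
          refine mul_le_mul_of_nonneg_left hW ?_
          have : 0 ≤ (T + 1) - (-T - 1) := by linarith
          have : 0 ≤ 1⁻¹ + Real.log (2 * M) := by rw [inv_one]; linarith [Real.log_nonneg h2M]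
          positivity
      _ ≤ 16 * C * (M + K) * T * L * B := by
          refine mul_le_mul_of_nonneg_right ?_ hB0
          have e : (T + 1) - (-T - 1) = 2 * (T + 1) := by ring
          rw [e, inv_one]
          have h3 : 2 * (M : ℝ) + K ≤ 2 * (M + K) := by linarith
          have h4 : 2 * (T + 1) ≤ 4 * T := by linarith
          have h5 : 1 + Real.log (2 * M) ≤ 4 * L := hlog2M
          have hl0 : 0 ≤ 1 + Real.log (2 * M) := by linarith [Real.log_nonneg h2M]
          calc C * (2 * M + K) * (2 * (T + 1)) * (1 + Real.log (2 * M))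
              ≤ C * (2 * (M + K)) * (4 * T) * (2 * L) := by
                have : 1 + Real.log (2 * M) ≤ 2 * L := by
                  have h2 : Real.log (2 * M) ≤ L := Real.log_le_log (by positivity) (by linarith)
                  have h14 : (1 : ℝ) ≤ L := by
                    have : Real.log 4 ≤ L := Real.log_le_log (by norm_num) (by linarith)
                    have h14' : (1 : ℝ) ≤ Real.log 4 := by
                      rw [Real.le_log_iff_exp_le (by norm_num)]
                      have := Real.exp_one_lt_d9; linarith
                    linarith
                  linarith
                gcongr
            _ = 16 * C * (M + K) * T * L := by ring
  -- Step 2: Abel summation for each point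
  have hS_eq : ∀ u, u ≤ 2 * M → ∀ (m : ℤ) (t : ℝ), S u m t =
      ∑ n ∈ Ioc M u, ∑ v ∈ (normLEStar (2 * M)).filter (fun v ↦ v.norm.natAbs = n),
        b v * ((((n : ℝ) ^ (-σ) : ℝ)) : ℂ) * ((n : ℂ) ^ (-((t : ℂ) * I))) * angularCharZ m v := by
    intro u hu m t
    simp only [hS, heckeSum]
    rw [sum_normLEStar_eq_sum_Icc]
    have hfloor : ⌊(2 * (M : ℝ))⌋₊ = 2 * M := by
      rw [show (2 * (M : ℝ)) = ((2 * M : ℕ) : ℝ) by push_cast; ring, Nat.floor_natCast]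
    rw [hfloor]
    -- terms with `n ≤ M` or `n > u` vanish
    rw [← sum_filter_add_sum_filter_not (Icc 1 (2 * M)) (fun n ↦ M < n ∧ n ≤ u)]
    have e : (Icc 1 (2 * M)).filter (fun n ↦ M < n ∧ n ≤ u) = Ioc M u := by
      ext n; simp; omega
    rw [e]
    have h0 : ∑ n ∈ (Icc 1 (2 * M)).filter (fun n ↦ ¬ (M < n ∧ n ≤ u)),
        ∑ v ∈ (normLEStar (2 * M)).filter (fun v ↦ v.norm.natAbs = n),
          a u v * ((v.norm.natAbs : ℕ) : ℂ) ^ (-((t : ℂ) * I)) * angularCharZ m v = 0 := by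
      refine sum_eq_zero fun n hn ↦ sum_eq_zero fun v hv ↦ ?_
      rw [mem_filter] at hn hv
      simp only [ha, hv.2, hn.2, if_false, zero_mul]
    rw [h0, add_zero]
    refine sum_congr rfl fun n hn ↦ sum_congr rfl fun v hv ↦ ?_
    rw [mem_Ioc] at hn
    rw [mem_filter] at hv
    simp only [ha, hv.2, hn, and_self, if_true]
  have hAbel : ∀ p ∈ Z, ‖∑ v ∈ Sh, b v * angularCharZ p.1 v * ((v.norm.natAbs : ℕ) : ℂ) ^ (-p.2)‖ ≤
      ‖S (2 * M) p.1 p.2.im‖ + ∑ u ∈ Ioo M (2 * M), ‖S u p.1 p.2.im‖ * (1 / (2 * (u : ℝ))) := by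
    intro p hp
    set δ : ℝ := p.2.re - σ with hδ
    have hδ0 : 0 ≤ δ := by rw [hδ]; linarith [(hre p hp).1]
    have hδ1 : δ ≤ 1 / 2 := by rw [hδ]; linarith [(hre p hp).2]
    -- `c_n = ∑_{N(v) = n} b_v λ^m(v) n^{-σ} n^{-iγ}`, `w_n = n^{-δ}`
    set c : ℕ → ℂ := fun n ↦ ∑ v ∈ (normLEStar (2 * M)).filter (fun v ↦ v.norm.natAbs = n),
      b v * ((((n : ℝ) ^ (-σ) : ℝ)) : ℂ) * ((n : ℂ) ^ (-((p.2.im : ℂ) * I))) * angularCharZ p.1 v with hc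
    set w : ℕ → ℝ := fun n ↦ (n : ℝ) ^ (-δ) with hw
    have hD : ∑ v ∈ Sh, b v * angularCharZ p.1 v * ((v.norm.natAbs : ℕ) : ℂ) ^ (-p.2) =
        ∑ n ∈ Ioc M (2 * M), c n * (w n : ℂ) := by
      rw [hSh, sum_filter, sum_normLEStar_eq_sum_Icc]
      have hfloor : ⌊(2 * (M : ℝ))⌋₊ = 2 * M := by
        rw [show (2 * (M : ℝ)) = ((2 * M : ℕ) : ℝ) by push_cast; ring, Nat.floor_natCast]
      rw [hfloor, ← sum_filter_add_sum_filter_not (Icc 1 (2 * M)) (fun n ↦ M < n)]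
      have e : (Icc 1 (2 * M)).filter (fun n ↦ M < n) = Ioc M (2 * M) := by ext n; simp; omega
      rw [e]
      have h0 : ∑ n ∈ (Icc 1 (2 * M)).filter (fun n ↦ ¬ M < n),
          ∑ v ∈ (normLEStar (2 * M)).filter (fun v ↦ v.norm.natAbs = n),
            (if M < v.norm.natAbs then b v * angularCharZ p.1 v * ((v.norm.natAbs : ℕ) : ℂ) ^ (-p.2) else 0) = 0 := by
        refine sum_eq_zero fun n hn ↦ sum_eq_zero fun v hv ↦ ?_
        rw [mem_filter] at hn hv
        rw [hv.2, if_neg hn.2]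
      rw [h0, add_zero]
      refine sum_congr rfl fun n hn ↦ ?_
      rw [mem_Ioc] at hn
      rw [hc, sum_mul]
      refine sum_congr rfl fun v hv ↦ ?_
      rw [mem_filter] at hv
      rw [hv.2, if_pos hn.1, natCast_cpow_neg_eq n (by omega) p.2 σ, hw, hδ]
      ring
    have hSc : ∀ u, u ≤ 2 * M → ∑ n ∈ Ioc M u, c n = S u p.1 p.2.im := fun u hu ↦ (hS_eq u hu p.1 p.2.im).symm
    rw [hD]
    have hM2 : (1 : ℝ) ≤ ((2 * M : ℕ) : ℝ) := by exact_mod_cast (by omega : 1 ≤ 2 * M)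
    have hw1 : w (2 * M) ≤ 1 := Real.rpow_le_one_of_one_le_of_nonpos hM2 (by linarith)
    have hw0 : 0 ≤ w (2 * M) := Real.rpow_nonneg (by positivity) _
    have hmono : ∀ u ∈ Ioo M (2 * M), w (u + 1) ≤ w u := by
      intro u hu
      simp only [mem_Ioo] at hu
      have hu0 : (0 : ℝ) < u := by exact_mod_cast (by omega : 0 < u)
      simp only [hw]
      push_cast
      exact Real.rpow_le_rpow_of_nonpos hu0 (by linarith) (by linarith)
    refine (norm_sum_Ioc_mul_le_abel c w M (by omega) hw1 hw0 hmono).trans ?_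
    rw [hSc (2 * M) le_rfl]
    refine add_le_add le_rfl (sum_le_sum fun u hu ↦ ?_)
    simp only [mem_Ioo] at hu
    rw [hSc u (by omega)]
    refine mul_le_mul_of_nonneg_left ?_ (norm_nonneg _)
    have hu1 : (1 : ℝ) ≤ u := by exact_mod_cast (by omega : 1 ≤ u)
    have := rpow_neg_sub_rpow_neg_succ_le hδ0 hδ1 hu1
    simp only [hw]
    push_cast
    exact this
  -- Step 3: sum over `Z`, Cauchy–Schwarz, and the uniform bound of Step 1
  set Q : ℝ := Real.sqrt (Z.card * (16 * C * (M + K) * T * L * B)) with hQ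
  have hQ0 : 0 ≤ Q := Real.sqrt_nonneg _
  have hCS : ∀ u, ∑ p ∈ Z, ‖S u p.1 p.2.im‖ ≤ Q := by
    intro u
    have h1 := sq_sum_le_card_mul_sum_sq (s := Z) (f := fun p ↦ ‖S u p.1 p.2.im‖)
    have h2 : (∑ p ∈ Z, ‖S u p.1 p.2.im‖) ^ 2 ≤ Z.card * (16 * C * (M + K) * T * L * B) :=
      h1.trans (mul_le_mul_of_nonneg_left (hMVTu u) (Nat.cast_nonneg _))
    rw [hQ]
    exact (Real.le_sqrt (sum_nonneg fun _ _ ↦ norm_nonneg _) (by positivity)).2 h2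
  have hsum_inv : ∑ u ∈ Ioo M (2 * M), (1 / (2 * (u : ℝ))) ≤ 1 / 2 := by
    have h1 : ∀ u ∈ Ioo M (2 * M), (1 / (2 * (u : ℝ))) ≤ 1 / (2 * ((M : ℝ) + 1)) := by
      intro u hu
      simp only [mem_Ioo] at hu
      have : (M : ℝ) + 1 ≤ u := by exact_mod_cast (by omega : M + 1 ≤ u)
      exact one_div_le_one_div_of_le (by positivity) (by linarith)
    refine (sum_le_sum h1).trans ?_
    rw [sum_const, nsmul_eq_mul, Nat.card_Ioo]
    have hM' : ((2 * M - M - 1 : ℕ) : ℝ) ≤ (M : ℝ) + 1 := by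
      have : 2 * M - M - 1 ≤ M + 1 := by omega
      exact_mod_cast this
    calc ((2 * M - M - 1 : ℕ) : ℝ) * (1 / (2 * ((M : ℝ) + 1)))
        ≤ ((M : ℝ) + 1) * (1 / (2 * ((M : ℝ) + 1))) := mul_le_mul_of_nonneg_right hM' (by positivity)
      _ = 1 / 2 := by field_simp
  have hmain : V * Z.card ≤ 3 / 2 * Q := by
    calc V * Z.card = ∑ p ∈ Z, V := by rw [sum_const, nsmul_eq_mul, mul_comm]
      _ ≤ ∑ p ∈ Z, ‖∑ v ∈ Sh, b v * angularCharZ p.1 v * ((v.norm.natAbs : ℕ) : ℂ) ^ (-p.2)‖ :=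
          sum_le_sum hlarge
      _ ≤ ∑ p ∈ Z, (‖S (2 * M) p.1 p.2.im‖ + ∑ u ∈ Ioo M (2 * M), ‖S u p.1 p.2.im‖ * (1 / (2 * (u : ℝ)))) :=
          sum_le_sum hAbel
      _ = ∑ p ∈ Z, ‖S (2 * M) p.1 p.2.im‖ +
            ∑ u ∈ Ioo M (2 * M), (1 / (2 * (u : ℝ))) * ∑ p ∈ Z, ‖S u p.1 p.2.im‖ := by
          rw [sum_add_distrib, sum_comm]
          congr 1
          refine sum_congr rfl fun u _ ↦ ?_
          rw [mul_sum]
          refine sum_congr rfl fun p _ ↦ by ring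
      _ ≤ Q + ∑ u ∈ Ioo M (2 * M), (1 / (2 * (u : ℝ))) * Q := by
          refine add_le_add (hCS (2 * M)) (sum_le_sum fun u _ ↦ ?_)
          exact mul_le_mul_of_nonneg_left (hCS u) (by positivity)
      _ = Q * (1 + ∑ u ∈ Ioo M (2 * M), (1 / (2 * (u : ℝ)))) := by
          rw [← sum_mul]; ring
      _ ≤ Q * (1 + 1 / 2) := mul_le_mul_of_nonneg_left (by linarith) hQ0
      _ = 3 / 2 * Q := by ring
  -- conclude
  have hK0 : 0 ≤ 16 * C * (M + K) * T * L * B := by positivity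
  have hsq : (V * Z.card) ^ 2 ≤ 9 / 4 * (Z.card * (16 * C * (M + K) * T * L * B)) := by
    have h := pow_le_pow_left₀ (by positivity) hmain 2
    have e : (3 / 2 * Q) ^ 2 = 9 / 4 * (Z.card * (16 * C * (M + K) * T * L * B)) := by
      rw [mul_pow, hQ, Real.sq_sqrt (by positivity)]; ring
    linarith
  rcases Nat.eq_zero_or_pos Z.card with hZ | hZ
  · rw [hZ]; simp only [Nat.cast_zero]; positivity
  · have hZ' : (0 : ℝ) < Z.card := by exact_mod_cast hZ
    rw [le_div_iff₀ (by positivity)]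
    have : (Z.card : ℝ) * V ^ 2 * Z.card ≤ 9 / 4 * (16 * C) * (M + K) * T * L * B * Z.card := by
      nlinarith
    exact le_of_mul_le_mul_right this hZ'

end GaussianHecke

end Literature.NumberTheory.LFunctions
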